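import Literature.AlgebraicGeometry.Motives.HypersurfaceContaining
import Literature.AlgebraicGeometry.Motives.SegreEmbedding
import HarnessLib

/-!
# Closed subsets of projective space are cut out by finitely many forms of one degree

Topic `Literature/AlgebraicGeometry/Motives` (family `hodge`; next to `HypersurfaceContaining`,
which proves that a proper closed subset of an embedded projective scheme lies on ONE hypersurface
section). PROVED here from Mathlib's `ProjectiveSpectrum` API, no named fact:

* `exists_forms_eq_iInter_zeroLocus_of_isClosed` — for a field `k` and a closed subset
  `W ⊆ ℙⁿ_k = Proj k[x₀, …, xₙ]` there are `d > 0` and homogeneous `g₁, …, g_m` of degree `d` with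
  `W = V₊(g₁) ∩ ⋯ ∩ V₊(g_m)` (Hartshorne II §2: the closed subsets of `Proj S` are the `V(𝔞)`,
  `𝔞` homogeneous; finitely many generators by Noetherianity; homogeneous components; padding the
  degrees by powers of the coordinates, which works because a point of `Proj` misses some `xⱼ`).

This is the input by which a countable family of PROJECTIVE parameter spaces (tuples of forms of
a fixed degree, equivalently tuples of hyperplanes after a Segre re-embedding) parametrises all
Zariski-closed subsets of the fibres of a projective family (structure theorem on algebraicity
loci, `HodgeTheory/AlgebraicityLocus*`).

## References

* [Hartshorne1977] R. Hartshorne, Algebraic Geometry (1977), II §2 (Prop. 2.5: definition of the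
  topology of `Proj`), II Ex. 5.10, I Ex. 2.14.
-/

noncomputable section

open AlgebraicGeometry CategoryTheory Topology

universe u

namespace Literature.AlgebraicGeometry.Motives

attribute [local instance] MvPolynomial.gradedAlgebra

variable {k : Type u} [Field k] {n : ℕ}

/-- The grading of `k[x₀, …, xₙ]` by degree (local notation; `ℙⁿ_k = Proj 𝓐`). [folklore] -/
local notation "𝓐" => MvPolynomial.homogeneousSubmodule (Fin (n + 1)) k

/-- A point of `ℙⁿ_k = Proj k[x₀,…,xₙ]` misses some coordinate: some `xⱼ ∉ 𝔮` (the irrelevant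
ideal, generated by the `xⱼ`, is not contained in `𝔮`). [folklore] -/
theorem exists_X_notMem (𝔮 : ProjectiveSpectrum 𝓐) :
    ∃ j : Fin (n + 1),
      (MvPolynomial.X j : MvPolynomial (Fin (n + 1)) k) ∉ 𝔮.asHomogeneousIdeal := by
  by_contra h
  push Not at h
  apply 𝔮.not_irrelevant_le
  intro p hp
  have hp' := Segre.irrelevant_le_span_X (Fin (n + 1)) k hp
  refine (Ideal.span_le.2 ?_) hp'
  rintro _ ⟨j, rfl⟩
  exact h j

/-- In a point `𝔮` of `ℙⁿ_k`, `xⱼᵃ · F ∈ 𝔮` with `xⱼ ∉ 𝔮` forces `F ∈ 𝔮` (`𝔮` is prime).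
[folklore] -/
theorem mem_of_X_pow_mul_mem (𝔮 : ProjectiveSpectrum 𝓐) {j : Fin (n + 1)}
    (hj : (MvPolynomial.X j : MvPolynomial (Fin (n + 1)) k) ∉ 𝔮.asHomogeneousIdeal) (a : ℕ)
    {F : MvPolynomial (Fin (n + 1)) k}
    (h : MvPolynomial.X j ^ a * F ∈ 𝔮.asHomogeneousIdeal) : F ∈ 𝔮.asHomogeneousIdeal := by
  rcases 𝔮.isPrime.mem_or_mem h with h1 | h1
  · exact (hj (𝔮.isPrime.mem_of_pow_mem a h1)).elim
  · exact h1

/-- **Closed subsets of projective space are cut out by finitely many forms of one positive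
degree.** For a field `k` and a closed subset `W ⊆ ℙⁿ_k`, there are `d > 0` and finitely many
homogeneous polynomials `g₁, …, g_m ∈ k[x₀, …, xₙ]` of degree `d` with
`W = V₊(g₁) ∩ ⋯ ∩ V₊(g_m)`. Proof (Hartshorne II §2, Prop. 2.5 and Ex. 2.14 / 5.10 style): `W` is
`V₊(s)` for a set `s` (definition of the topology of `Proj`), `= V₊(t)` for a finite `t` (the
polynomial ring is Noetherian and `V₊` only depends on the generated ideal), `= ⋂ V₊(f_e)` over the
homogeneous components `f_e` of the `f ∈ t` (points are homogeneous primes), the degree-`0`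
components vanish when `W ≠ ∅` (non-zero constants are units), and a component of degree
`e ≥ 1` is replaced by the forms `xⱼ^{D-e} f_e` of the common degree `D = max deg` (a point misses
some `xⱼ`, and is prime). [cite: Hartshorne1977, II §2 Prop. 2.5 and Ex. 5.10] -/
theorem exists_forms_eq_iInter_zeroLocus_of_isClosed {W : Set (ProjectiveSpectrum 𝓐)}
    (hW : IsClosed W) :
    ∃ (d m : ℕ) (g : Fin m → MvPolynomial (Fin (n + 1)) k), 0 < d ∧
      (∀ i, (g i).IsHomogeneous d) ∧
      W = ⋂ i, ProjectiveSpectrum.zeroLocus 𝓐 {g i} := by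
  classical
  -- the empty case: `W = ⋂ⱼ V₊(xⱼ)`
  rcases W.eq_empty_or_nonempty with rfl | ⟨𝔮₀, h𝔮₀⟩
  · refine ⟨1, n + 1, fun j => MvPolynomial.X j, Nat.one_pos,
      fun j => MvPolynomial.isHomogeneous_X k j, ?_⟩
    symm
    refine Set.eq_empty_of_forall_notMem fun 𝔮 h𝔮 => ?_
    obtain ⟨j, hj⟩ := exists_X_notMem 𝔮
    have h := Set.mem_iInter.1 h𝔮 j
    rw [ProjectiveSpectrum.mem_zeroLocus, Set.singleton_subset_iff] at h
    exact hj h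
  -- `W = V₊(s) = V₊(t)`, `t` finite
  obtain ⟨s, hs⟩ := (ProjectiveSpectrum.isClosed_iff_zeroLocus (𝒜 := 𝓐) _).1 hW
  obtain ⟨t, ht⟩ : (Ideal.span s).FG := (isNoetherianRing_iff_ideal_fg _).1 inferInstance _
  have hWt : W = ProjectiveSpectrum.zeroLocus 𝓐 (t : Set (MvPolynomial (Fin (n + 1)) k)) := by
    rw [hs, ← ProjectiveSpectrum.zeroLocus_span 𝓐 s, ← ht, ProjectiveSpectrum.zeroLocus_span]
  -- membership in a point in terms of homogeneous components
  have hmem : ∀ (𝔮 : ProjectiveSpectrum 𝓐) (f : MvPolynomial (Fin (n + 1)) k),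
      f ∈ 𝔮.asHomogeneousIdeal ↔
        ∀ e, (DirectSum.decompose 𝓐 f e : MvPolynomial (Fin (n + 1)) k) ∈ 𝔮.asHomogeneousIdeal :=
    fun 𝔮 f => Ideal.IsHomogeneous.mem_iff 𝓐 𝔮.asHomogeneousIdeal.isHomogeneous
  -- degree-`0` components of the `f ∈ t` vanish (`W ≠ ∅`)
  have h0 : ∀ f ∈ t, (DirectSum.decompose 𝓐 f 0 : MvPolynomial (Fin (n + 1)) k) = 0 := by
    intro f hf
    refine decompose_zero_eq_zero_of_mem 𝔮₀ ?_
    have h := hWt ▸ h𝔮₀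
    exact (ProjectiveSpectrum.mem_zeroLocus _ _ _).1 h hf
  -- components: `(decompose f)_e` is the homogeneous component of degree `e`
  have hcomp : ∀ (f : MvPolynomial (Fin (n + 1)) k) (e : ℕ),
      (DirectSum.decompose 𝓐 f e : MvPolynomial (Fin (n + 1)) k) =
        MvPolynomial.homogeneousComponent e f := fun f e =>
    MvPolynomial.decomposition.decompose'_apply f e
  -- a bound `D` on the degrees, and the common degree `d ≥ 1`
  obtain ⟨D, hD⟩ : ∃ D : ℕ, ∀ f ∈ t, f.totalDegree ≤ D :=
    ⟨t.sup MvPolynomial.totalDegree, fun f hf => Finset.le_sup (f := MvPolynomial.totalDegree) hf⟩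
  have hvan : ∀ f ∈ t, ∀ e, D < e →
      (DirectSum.decompose 𝓐 f e : MvPolynomial (Fin (n + 1)) k) = 0 := by
    intro f hf e he
    rw [hcomp]
    exact MvPolynomial.homogeneousComponent_eq_zero e f (lt_of_le_of_lt (hD f hf) he)
  obtain ⟨d, hd1, hdD⟩ : ∃ d : ℕ, 1 ≤ d ∧ D ≤ d := ⟨max 1 D, le_max_left _ _, le_max_right _ _⟩
  -- the padded forms, indexed by `(f, e, j)` with `f ∈ t`, `1 ≤ e + 1 ≤ D`, `j` a coordinate
  obtain ⟨G, hG⟩ : ∃ G : ↥t × Fin D × Fin (n + 1) → MvPolynomial (Fin (n + 1)) k, ∀ i,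
      G i = MvPolynomial.X i.2.2 ^ (d - (i.2.1 + 1)) *
        (DirectSum.decompose 𝓐 (i.1 : MvPolynomial (Fin (n + 1)) k) (i.2.1 + 1) :
          MvPolynomial (Fin (n + 1)) k) := ⟨_, fun i => rfl⟩
  have hGhom : ∀ i, (G i).IsHomogeneous d := by
    intro i
    have h1 : (DirectSum.decompose 𝓐 (i.1 : MvPolynomial (Fin (n + 1)) k) (i.2.1 + 1) :
        MvPolynomial (Fin (n + 1)) k).IsHomogeneous (i.2.1 + 1) :=
      (MvPolynomial.mem_homogeneousSubmodule _ _).1 (SetLike.coe_mem _)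
    have h2 : (MvPolynomial.X i.2.2 ^ (d - (i.2.1 + 1)) :
        MvPolynomial (Fin (n + 1)) k).IsHomogeneous (1 * (d - (i.2.1 + 1))) :=
      (MvPolynomial.isHomogeneous_X k i.2.2).pow (d - (i.2.1 + 1))
    rw [one_mul] at h2
    have hle : i.2.1 + 1 ≤ d := le_trans (Nat.succ_le_of_lt i.2.1.2) hdD
    have h := h2.mul h1
    rw [Nat.sub_add_cancel hle] at h
    rw [hG]
    exact h
  -- `W = ⋂ V₊(G i)`
  have hWG : W = ⋂ i, ProjectiveSpectrum.zeroLocus 𝓐 {G i} := by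
    apply Set.Subset.antisymm
    · intro 𝔮 h𝔮
      refine Set.mem_iInter.2 fun i => ?_
      rw [ProjectiveSpectrum.mem_zeroLocus, Set.singleton_subset_iff, hG]
      refine Ideal.mul_mem_left _ _ ?_
      have hf : (i.1 : MvPolynomial (Fin (n + 1)) k) ∈ 𝔮.asHomogeneousIdeal :=
        (ProjectiveSpectrum.mem_zeroLocus _ _ _).1 (hWt ▸ h𝔮) i.1.2
      exact (hmem 𝔮 _).1 hf _
    · intro 𝔮 h𝔮
      rw [hWt, ProjectiveSpectrum.mem_zeroLocus]
      intro f hf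
      refine (hmem 𝔮 f).2 fun e => ?_
      rcases Nat.eq_zero_or_pos e with rfl | he
      · rw [h0 f hf]
        exact zero_mem _
      · by_cases heD : D < e
        · rw [hvan f hf e heD]
          exact zero_mem _
        · push Not at heD
          obtain ⟨j, hj⟩ := exists_X_notMem 𝔮
          have hlt : e - 1 < D := by omega
          have h := Set.mem_iInter.1 h𝔮 (⟨f, hf⟩, ⟨e - 1, hlt⟩, j)
          rw [ProjectiveSpectrum.mem_zeroLocus, Set.singleton_subset_iff, hG] at h
          have he1 : e - 1 + 1 = e := by omega
          dsimp only at h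
          rw [he1] at h
          exact mem_of_X_pow_mul_mem 𝔮 hj _ h
  -- reindex by `Fin m`
  obtain ⟨m, ⟨ε⟩⟩ := Finite.exists_equiv_fin (↥t × Fin D × Fin (n + 1))
  refine ⟨d, m, G ∘ ε.symm, hd1, fun i => hGhom _, ?_⟩
  rw [hWG]
  ext 𝔮
  simp only [Set.mem_iInter, Function.comp_apply]
  exact ⟨fun h i => h (ε.symm i), fun h i => by simpa using h (ε i)⟩

end Literature.AlgebraicGeometry.Motives

end
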